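import Summits.QuantumFields.YangMills.Theorems.FlatTubeReductionKernelParityExp
import HarnessLib

/-!
# Kernel parity, the SPLIT: every exponent decomposes EXACTLY into an even and an odd part under an involution — how to instantiate `K₂ = K₁·exp(A + R)`
# (route `FlatTubeReduction`, crux K1 `NearFlatRatioLaw` stmt-QuantumFields-24720, registered stub `stub_boRate` = FCL 23943's `BORateAll`; line «borate»;
# rung R2b1 = RECORD-label femto gap; no summit statement is proved here)

Seat `ym-line-ftr-p1` g7 (prover).  The parity lemmas (`…KernelParity` p632175, `…KernelParityExp` p637527, `…KernelParityFloor`) consume a factorisation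
`K₂ = K₁·exp(A + R)` with `K₁` even and `A` odd under a measure-preserving involution `ι` (the fibre reflection `w ↦ −w` of the tube chart).  This file records the
canonical way to produce it from a kernel given as `K₂ = K_M·exp(E)` (model `K_M` even, exponent `E` = −β × the chart expansion of the action, e.g. lane A's quadratic model
plus the CUBIC part of `…StepCubic` plus a quartic remainder): split `E` into `E_even = (E + E∘(ι×ι))/2` and `E_odd = (E − E∘(ι×ι))/2`.  Then EXACTLY
`K₂ = [K_M·exp(E_even)]·exp(E_odd)`, the bracket is `ι`-even, `E_odd` is `ι`-odd, and `|E_odd| ≤ a` follows from ANY bound `|E(x,y) − E(ιx,ιy)| ≤ 2a` (for the step action: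
twice the cubic term plus quartic remainders, `…StepCubic.abs_wilsonAction_step_sub_cubic_le`).  The even factor `exp(E_even)` is then compared with the c-frozen fibred
model at SECOND order (the `R` of `kernel_near_odd_of_exp`).
* `evenPart_ι`, `oddPart_ι` — parity of the two halves (ι involutive); `exp_split` — `exp E = exp(E_even)·exp(E_odd)`;
* ★ `kernel_exp_split` — `K_M` even, `K₂ = K_M·exp E` ⇒ with `K₁ := K_M·exp(E_even)`, `A := E_odd`: `K₂ = K₁·exp(A + 0)`, `K₁` even, `A` odd, `0 ≤ K₁` if `0 ≤ K_M`;
* `abs_oddPart_le` — `|E(x,y) − E(ιx,ιy)| ≤ 2a ⇒ |E_odd(x,y)| ≤ a`.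
HONEST FRAMING: trivial algebra, recorded so that the chart seat's instantiation is mechanical; for the registered stub of a crux of the CONDITIONAL reduction route to the
femto rung R2b1 (RECORD label); nothing here is infinite volume, a continuum limit or the Clay mass gap.  No definitions, no `sorry`.

## References
* M. Lüscher, Nucl. Phys. B219 (1983) 233, §3 (parity of the cubic vertex) — [cite: Luscher1983, §3].
-/

set_option autoImplicit false

noncomputable section

namespace Summit.QuantumFields.YangMills.Theorems.FemtoTransferGap.KernelParity

variable {X : Type*}

/-- The even half `(E(x,y) + E(ιx,ιy))/2` is `ι`-even when `ι` is an involution. [folklore] -/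
theorem evenPart_ι (ι : X → X) (hι : ∀ x, ι (ι x) = x) (E : X → X → ℝ) (x y : X) :
    (E (ι x) (ι y) + E (ι (ι x)) (ι (ι y))) / 2 = (E x y + E (ι x) (ι y)) / 2 := by
  rw [hι, hι]; ring

/-- The odd half `(E(x,y) − E(ιx,ιy))/2` is `ι`-odd when `ι` is an involution. [folklore] -/
theorem oddPart_ι (ι : X → X) (hι : ∀ x, ι (ι x) = x) (E : X → X → ℝ) (x y : X) :
    (E (ι x) (ι y) - E (ι (ι x)) (ι (ι y))) / 2 = -((E x y - E (ι x) (ι y)) / 2) := by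
  rw [hι, hι]; ring

/-- `exp E = exp(E_even)·exp(E_odd)`. [folklore] -/
theorem exp_split (E : X → X → ℝ) (ι : X → X) (x y : X) :
    Real.exp (E x y) = Real.exp ((E x y + E (ι x) (ι y)) / 2) * Real.exp ((E x y - E (ι x) (ι y)) / 2) := by
  rw [← Real.exp_add]; congr 1; ring

/-- `|E(x,y) − E(ιx,ιy)| ≤ 2a ⇒ |E_odd(x,y)| ≤ a`. [folklore] -/
theorem abs_oddPart_le {E : X → X → ℝ} {ι : X → X} {a : ℝ} (h : ∀ x y, |E x y - E (ι x) (ι y)| ≤ 2 * a) (x y : X) :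
    |(E x y - E (ι x) (ι y)) / 2| ≤ a := by
  rw [abs_div, abs_two]
  have := h x y
  linarith

/-- ★ **The canonical parity split of a kernel given by an exponent over an even model.**  `K_M` `ι`-even and nonnegative, `K₂ = K_M·exp E`.  With
`K₁(x,y) := K_M(x,y)·exp((E(x,y) + E(ιx,ιy))/2)` and `A(x,y) := (E(x,y) − E(ιx,ιy))/2`:  `K₂ = K₁·exp(A + 0)` pointwise, `K₁` is `ι`-even and nonnegative, `A` is `ι`-odd —
exactly the hypotheses `hK₂`, `hK₁ι`, `hAι`, `hK₁` of `kernel_near_odd_of_exp` / `abs_form_sub_le_of_exp_near_odd` / `form_ge_of_exp_near_odd` (with `R = 0` at this stage;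
the second-order remainder `R` appears when `K₁` is in turn compared with the c-frozen fibred model).  Symmetry of `K₁` in `(x,y)` is inherited from that of `K_M` and `E`.
[cite: Luscher1983, §3] -/
theorem kernel_exp_split (ι : X → X) (hι : ∀ x, ι (ι x) = x) {K_M K₂ E : X → X → ℝ} (hKM : ∀ x y, 0 ≤ K_M x y)
    (hKMι : ∀ x y, K_M (ι x) (ι y) = K_M x y) (hK₂ : ∀ x y, K₂ x y = K_M x y * Real.exp (E x y)) :
    (∀ x y, K₂ x y = (K_M x y * Real.exp ((E x y + E (ι x) (ι y)) / 2)) * Real.exp ((E x y - E (ι x) (ι y)) / 2 + 0)) ∧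
      (∀ x y, K_M (ι x) (ι y) * Real.exp ((E (ι x) (ι y) + E (ι (ι x)) (ι (ι y))) / 2) = K_M x y * Real.exp ((E x y + E (ι x) (ι y)) / 2)) ∧
      (∀ x y, (E (ι x) (ι y) - E (ι (ι x)) (ι (ι y))) / 2 = -((E x y - E (ι x) (ι y)) / 2)) ∧
      (∀ x y, 0 ≤ K_M x y * Real.exp ((E x y + E (ι x) (ι y)) / 2)) := by
  refine ⟨fun x y => ?_, fun x y => ?_, fun x y => oddPart_ι ι hι E x y, fun x y => mul_nonneg (hKM x y) (Real.exp_pos _).le⟩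
  · rw [hK₂, add_zero, exp_split E ι x y, mul_assoc]
  · rw [hKMι, evenPart_ι ι hι E x y]

/-- Symmetry of the even factor: if `K_M` and `E` are symmetric then `K₁(x,y) = K₁(y,x)`. [folklore] -/
theorem kernel_exp_split_symm (ι : X → X) {K_M E : X → X → ℝ} (hKMs : ∀ x y, K_M x y = K_M y x) (hEs : ∀ x y, E x y = E y x) (x y : X) :
    K_M x y * Real.exp ((E x y + E (ι x) (ι y)) / 2) = K_M y x * Real.exp ((E y x + E (ι y) (ι x)) / 2) := by
  rw [hKMs, hEs x y, hEs (ι x) (ι y)]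

end Summit.QuantumFields.YangMills.Theorems.FemtoTransferGap.KernelParity

end
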